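import Summits.CriticalPhenomena.Ising3D.TaylorRegionCertsH
import Summits.CriticalPhenomena.Ising3D.TaylorRegionCheckHybridL
import Summits.CriticalPhenomena.Ising3D.TaylorTableDecOfCertsH
import Mathlib.Tactic.Linarith
import HarnessLib

/-!
# Turnkey hybrid region certificates, LOCAL-PRODUCT even check; the single-Boolean γ-certificates
(cell `pub-ising3x`, seat recog-1 gen 11; gate (g2) — `TaylorRegionCertsH` × `TaylorRegionCheckHybridL` glue)

HONEST FRAMING: lottery ticket; floor = tightest certified 3D Ising CFT bounds; no exact-solution
claim without a proof. Island framing: certified exclusion region at stated derivative order and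
assumptions; not a determination of the 3D Ising critical exponents beyond that.

`EvenRegionCertH.checkL` (same certificate data; the even data is checked by `EvenRegionDataH.checkL`, whose
discriminant legs never expand `4XY − Z²` in the monomial basis — MEASURED necessity for boxes of positive width,
see `TaylorRegionCheckHybridL`), `taylorEvenRegion_of_certHL`, `TaylorTable.evenRegion_of_evenCertHL`, and the
all-Boolean capstone **`TaylorTable.boxExcluded_of_taylorTable_dec_of_certsHL`**:
`T.check = true → T.checkEncl = true → (T.evenCertH πE).checkL = true → (T.oddCertH πO).check = true → BoxExcluded T.box`.
`gammaCheckH` / `gammaCheckHL` fold the four Booleans into one (`boxExcluded_of_gammaCheckH(L)`): a kind-`deriv`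
box certificate is ONE `decide +kernel`. Region side SUFFICIENT only, as documented upstream. Elementary glue. [folklore]
-/

namespace Summit.CriticalPhenomena.Ising3D

open Set
open Literature.Analysis.ValidatedNumerics Literature.Analysis.ValidatedNumerics.PolyMP
open Literature.Analysis.ValidatedNumerics.NumericsMP (MI)
open Literature.MathematicalPhysics.QuantumFieldTheory.ConformalBootstrap3D

namespace EvenRegionCertH

/-- The hybrid even certificate checked in LOCAL-PRODUCT form. [folklore] -/
def checkL (c : EvenRegionCertH) : Bool := decide c.l.Nodup && c.data.checkL

end EvenRegionCertH

/-- **Hybrid even region for a rational box from one Boolean, local-product form.** [folklore] -/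
theorem taylorEvenRegion_of_certHL (c : EvenRegionCertH) (h : c.checkL = true) :
    TaylorEvenRegion (taylorCrossing (1 / 2) (1 / 2) c.l.toFinset fun i ab => (c.cQ i ab : ℝ))
      (Icc (c.box.σlo : ℝ) c.box.σhi ×ˢ Icc (c.box.εlo : ℝ) c.box.εhi) ((c.E0 : ℚ) : ℝ) := by
  simp only [EvenRegionCertH.checkL, Bool.and_eq_true, decide_eq_true_eq] at h
  obtain ⟨hl, hd⟩ := h
  refine taylorEvenRegion_of_evenRegionCheckHL c.data hl _ (fun p hp => ?_) hd
  obtain ⟨h1, h2, h3, h4⟩ := BoxQ.bounds (B := c.box) hp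
  refine ⟨mem_enclQ _ h1 h2, mem_enclQ _ h3 h4, mem_enclQ _ ?_ ?_⟩
  · push_cast; linarith
  · push_cast; linarith

namespace TaylorTable

variable (T : TaylorTable)

/-- **The even REGION field of the table from its hybrid certificate, local-product form.** [folklore] -/
theorem evenRegion_of_evenCertHL (π : EvenRegionParamsH) (h : (T.evenCertH π).checkL = true) :
    TaylorEvenRegion T.α T.box ((T.E₀ : ℚ) : ℝ) :=
  taylorEvenRegion_of_certHL (T.evenCertH π) h

/-- **All-Boolean capstone, hybrid route, local-product even check.** [folklore] -/
theorem boxExcluded_of_taylorTable_dec_of_certsHL (h : T.check = true) (he : T.checkEncl = true)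
    (πE : EvenRegionParamsH) (hE : (T.evenCertH πE).checkL = true)
    (πO : OddConeParamsH) (hO : (T.oddCertH πO).check = true) : BoxExcluded T.box :=
  T.boxExcluded_of_taylorTable_dec h he (T.evenRegion_of_evenCertHL πE hE) (T.oddCone_of_oddCertH πO hO)

/-- The four Booleans as ONE (hybrid route): table check, enclosure check, both region checks. [folklore] -/
def gammaCheckH (πE : EvenRegionParamsH) (πO : OddConeParamsH) : Bool :=
  T.check && T.checkEncl && (T.evenCertH πE).check && (T.oddCertH πO).check

/-- **`BoxExcluded` from the single Boolean `gammaCheckH`.** [folklore] -/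
theorem boxExcluded_of_gammaCheckH (πE : EvenRegionParamsH) (πO : OddConeParamsH)
    (h : T.gammaCheckH πE πO = true) : BoxExcluded T.box := by
  simp only [gammaCheckH, Bool.and_eq_true] at h
  obtain ⟨⟨⟨h1, h2⟩, h3⟩, h4⟩ := h
  exact T.boxExcluded_of_taylorTable_dec_of_certsH h1 h2 πE h3 πO h4

/-- The four Booleans as ONE (hybrid route, local-product even check). [folklore] -/
def gammaCheckHL (πE : EvenRegionParamsH) (πO : OddConeParamsH) : Bool :=
  T.check && T.checkEncl && (T.evenCertH πE).checkL && (T.oddCertH πO).check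

/-- **`BoxExcluded` from the single Boolean `gammaCheckHL`.** [folklore] -/
theorem boxExcluded_of_gammaCheckHL (πE : EvenRegionParamsH) (πO : OddConeParamsH)
    (h : T.gammaCheckHL πE πO = true) : BoxExcluded T.box := by
  simp only [gammaCheckHL, Bool.and_eq_true] at h
  obtain ⟨⟨⟨h1, h2⟩, h3⟩, h4⟩ := h
  exact T.boxExcluded_of_taylorTable_dec_of_certsHL h1 h2 πE h3 πO h4

end TaylorTable

/-! ### Fixture: the turnkey local-product pipeline runs in the kernel (the tree's toy hybrid even certificate) -/

/-- [folklore] -/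
theorem toyEvenRegionCertH_checkL : toyEvenRegionCertH.checkL = true := by
  decide +kernel

end Summit.CriticalPhenomena.Ising3D
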